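import Literature.Computability.Cryptography.BlumMicaliMachine3
import HarnessLib

/-!
# Blum–Micali, Theorem 3: discharge of the named fact

`Literature.Computability.Cryptography.blumMicali_halfPredicate_dlog` (`BlumMicali.lean`: the half
predicate `B_{p,g}` of the discrete logarithm is as hard as the discrete logarithm, per-`(p,g)`
form with Monte-Carlo truncation) is proved by combining

* `blumMicali_halfPredicate_dlog_of_isPolyTime` (`BlumMicaliAlgorithm.lean`): the reduction as the
  oracle computation `bmComp Q`, its success probability `≥ 2/3` (Lemmas 1–2, the union bound,
  Chebyshev), so that the fact follows from polynomial time of its step function; and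
* `bmOracleAlg_isPolyTime_holds` (`BlumMicaliMachine3.lean`): that step function is computed by a
  stack program with polynomial cost, hence is `TM2`-polynomial-time.

## References

* M. Blum, S. Micali, *How to generate cryptographically strong sequences of pseudo-random bits*,
  SIAM J. Comput. 13 (1984) 850–864, §3.3, Theorem 3.
-/

namespace Literature.Computability.Cryptography

/-- **Blum–Micali 1984, Theorem 3** (discharge of the named fact `blumMicali_halfPredicate_dlog`):
for every polynomial `Q > 0` there is a polynomial-time oracle algorithm which, for every oracle
answering `B_{p,g}` correctly on a `1/2 + 1/Q(|p|)` fraction of `ℤ_p^*`, outputs the discrete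
logarithm of any unit `y` with probability `≥ 2/3`. [cite: BlumMicali1984, Theorem 3] -/
theorem blumMicali_halfPredicate_dlog_holds : blumMicali_halfPredicate_dlog :=
  blumMicali_halfPredicate_dlog_of_isPolyTime bmOracleAlg_isPolyTime_holds

end Literature.Computability.Cryptography
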